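import Mathlib.Analysis.PSeries
import Literature.NumberTheory.LFunctions.ExplicitFormulaPsiCharHeights
import HarnessLib

/-!
# The non-trivial zeros of `L(s, χ)` as an index type: truncations and `Σ m(ρ)/(1 + γ²) < ∞`

Topic `Literature/NumberTheory/LFunctions`, sub-namespace `ExplicitPsiChar`. Everything in this
file is PROVED; the two definitions are glue (the character analogues of the tree's
`ZetaZeros.riemannZetaNontrivialZeros` / `weilZeroFinset` for `ζ`).

For a Dirichlet character `χ` mod `q`:

* `charNontrivialZeros χ = {ρ : L(ρ, χ) = 0, 0 < Re ρ < 1}` (so that the tree's boxes are its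
  truncations: `lfunctionZeroBox χ T = charNontrivialZeros χ ∩ {|Im ρ| ≤ T}`, `lfunctionZeroBox_eq_inter`);
* `charZeroFinset hχ T` — the truncation `|Im ρ| ≤ T` as a `Finset` of the subtype (`χ ≠ χ₀`), with
  `mem_charZeroFinset`, `tendsto_charZeroFinset` (the truncations exhaust) and `sum_charZeroFinset_eq`
  (its sums are the `Finset` sums over `(lfunctionZeroBox_finite hχ T).toFinset`);
* `summable_zeroOrder_div_one_add_sq` — for primitive `χ` mod `q > 1`,
  **`Σ_ρ m(ρ)/(1 + γ²) < ∞`** over the non-trivial zeros counted with multiplicity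
  `m = DirichletDisc.zeroOrder χ` (Montgomery–Vaughan Thm. 10.17: `N(T+1, χ) − N(T, χ) ≪ log qT`,
  in the tree as `ExplicitPsiChar.exists_sum_window_le`; summing `log(q(|k|+4))/(1+k²)` over the
  windows `k ∈ ℤ`).

These carry the absolutely convergent zero sums of smoothed explicit formulae for `L(s, χ)`
(Heath-Brown 1992, Lemma 5.1; the character analogue of the tree's `SmoothedExplicitFormulaContour`).

## References

* H. L. Montgomery, R. C. Vaughan, *Multiplicative Number Theory I*, Thm. 10.17.
  [cite: MontgomeryVaughan2007, Theorem 10.17]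
* D. R. Heath-Brown, Proc. London Math. Soc. (3) 64 (1992), Lemma 5.1. [cite: HeathBrown1992PLMS, Lemma 5.1]
-/

noncomputable section

open Complex Filter Topology Set Finset

namespace Literature.NumberTheory.LFunctions

namespace ExplicitPsiChar

variable {q : ℕ} [NeZero q]

/-! ### The set of non-trivial zeros -/

/-- The non-trivial zeros of `L(s, χ)`: `L(ρ, χ) = 0` with `0 < Re ρ < 1` (each listed once; the
multiplicity is `DirichletDisc.zeroOrder χ ρ`). [cite: MontgomeryVaughan2007, Corollary 10.8] -/
def charNontrivialZeros (χ : DirichletCharacter ℂ q) : Set ℂ :=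
  {ρ | χ.LFunction ρ = 0 ∧ 0 < ρ.re ∧ ρ.re < 1}

variable {χ : DirichletCharacter ℂ q}

/-- Membership. [folklore] -/
theorem mem_charNontrivialZeros {ρ : ℂ} :
    ρ ∈ charNontrivialZeros χ ↔ χ.LFunction ρ = 0 ∧ 0 < ρ.re ∧ ρ.re < 1 := Iff.rfl

/-- The boxes of the tree are the truncations: `lfunctionZeroBox χ T = charNontrivialZeros χ ∩ {|Im ρ| ≤ T}`.
[folklore] -/
theorem lfunctionZeroBox_eq_inter (χ : DirichletCharacter ℂ q) (T : ℝ) :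
    lfunctionZeroBox χ T = charNontrivialZeros χ ∩ {ρ | |ρ.im| ≤ T} := by
  ext ρ
  simp only [mem_lfunctionZeroBox, mem_inter_iff, mem_charNontrivialZeros, mem_setOf_eq, and_assoc]

/-- For `ρ ∈ charNontrivialZeros χ` (`χ ≠ χ₀`): `m(ρ) ≥ 1`. [folklore] -/
theorem one_le_zeroOrder_of_mem (hχ : χ ≠ 1) {ρ : ℂ} (hρ : ρ ∈ charNontrivialZeros χ) :
    1 ≤ DirichletDisc.zeroOrder χ ρ :=
  (DirichletDisc.zeroOrder_pos_iff χ hχ ρ).2 hρ.1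

/-! ### Truncations as finsets of the subtype -/

/-- The zeros with `|Im ρ| ≤ T`, inside the subtype `charNontrivialZeros χ`, as a `Finset` (`χ ≠ χ₀`).
[folklore] -/
def charZeroFinset (hχ : χ ≠ 1) (T : ℝ) : Finset (charNontrivialZeros χ) :=
  ((lfunctionZeroBox_finite hχ T).preimage Subtype.val_injective.injOn).toFinset

/-- Membership in `charZeroFinset hχ T` is `|Im ρ| ≤ T`. [folklore] -/
theorem mem_charZeroFinset {hχ : χ ≠ 1} {T : ℝ} {ρ : charNontrivialZeros χ} :
    ρ ∈ charZeroFinset hχ T ↔ |(ρ : ℂ).im| ≤ T := by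
  simp only [charZeroFinset, Set.Finite.mem_toFinset, Set.mem_preimage, lfunctionZeroBox_eq_inter,
    Set.mem_inter_iff, Set.mem_setOf_eq, Subtype.coe_prop, true_and]

/-- The truncations exhaust: `charZeroFinset hχ T → atTop`. [folklore] -/
theorem tendsto_charZeroFinset (hχ : χ ≠ 1) : Tendsto (charZeroFinset hχ) atTop atTop := by
  refine tendsto_atTop.2 fun s => ?_
  filter_upwards [eventually_ge_atTop (∑ ρ ∈ s, |(ρ : ℂ).im|)] with T hT
  intro ρ hρ
  rw [mem_charZeroFinset]
  exact (Finset.single_le_sum (f := fun ρ : charNontrivialZeros χ => |(ρ : ℂ).im|)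
    (fun ρ _ => abs_nonneg _) hρ).trans hT

/-- Sums over `charZeroFinset hχ T` are the `Finset` sums over the box `lfunctionZeroBox χ T`.
[folklore] -/
theorem sum_charZeroFinset_eq {M : Type*} [AddCommMonoid M] (hχ : χ ≠ 1) (T : ℝ) (F : ℂ → M) :
    ∑ ρ ∈ charZeroFinset hχ T, F ρ = ∑ z ∈ (lfunctionZeroBox_finite hχ T).toFinset, F z := by
  classical
  have e : ∑ ρ ∈ charZeroFinset hχ T, F ρ =
      ∑ z ∈ (charZeroFinset hχ T).map (Function.Embedding.subtype _), F z := by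
    rw [Finset.sum_map]
    rfl
  rw [e]
  refine Finset.sum_congr ?_ fun _ _ => rfl
  ext z
  simp only [Finset.mem_map, Function.Embedding.subtype_apply, Set.Finite.mem_toFinset]
  constructor
  · rintro ⟨ρ, hρ, rfl⟩
    rw [lfunctionZeroBox_eq_inter]
    exact ⟨ρ.2, mem_charZeroFinset.1 hρ⟩
  · intro hz
    rw [lfunctionZeroBox_eq_inter] at hz
    exact ⟨⟨z, hz.1⟩, mem_charZeroFinset.2 hz.2, rfl⟩

/-! ### `Σ m(ρ)/(1 + γ²) < ∞` -/

/-- `log x ≤ 2 √x` for `x > 0` (local copy; the tree has the same two-liner in several files). [folklore] -/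
private theorem log_le_two_mul_sqrt {x : ℝ} (hx : 0 < x) : Real.log x ≤ 2 * Real.sqrt x := by
  have h1 : Real.log (Real.sqrt x) ≤ Real.sqrt x - 1 := Real.log_le_sub_one_of_pos (Real.sqrt_pos.2 hx)
  have h2 : Real.log x = 2 * Real.log (Real.sqrt x) := by
    rw [Real.log_sqrt hx.le]; ring
  linarith

/-- The window weights `(A + log(|k| + 4))/(1 + k²)` are summable over `k ∈ ℤ` (`A ≥ 0`). [folklore] -/
theorem summable_window_weight {A : ℝ} (hA : 0 ≤ A) :
    Summable fun k : ℤ => (A + Real.log (|(k : ℝ)| + 4)) / (1 + (k : ℝ) ^ 2) := by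
  -- majorant `(2A + 8) (1 + |k|)^{-3/2}`
  have hg : Summable fun k : ℤ => (2 * A + 8) * (1 + |(k : ℝ)|) ^ (-(3 / 2 : ℝ)) := by
    refine Summable.mul_left _ ?_
    have hnat : Summable fun n : ℕ => (1 + (n : ℝ)) ^ (-(3 / 2 : ℝ)) := by
      have h := (summable_nat_add_iff 1).2 (Real.summable_nat_rpow_inv.2 (by norm_num : (1 : ℝ) < 3 / 2))
      refine h.congr fun n => ?_
      simp only [Nat.cast_add, Nat.cast_one]
      rw [Real.rpow_neg (by positivity), add_comm]
    refine Summable.of_nat_of_neg ?_ ?_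
    · refine hnat.congr fun n => ?_
      simp only [Int.cast_natCast, Nat.abs_cast]
    · refine hnat.congr fun n => ?_
      simp only [Int.cast_neg, Int.cast_natCast, abs_neg, Nat.abs_cast]
  refine Summable.of_nonneg_of_le (fun k => ?_) (fun k => ?_) hg
  · have : 0 ≤ Real.log (|(k : ℝ)| + 4) := Real.log_nonneg (by linarith [abs_nonneg (k : ℝ)])
    positivity
  · set a : ℝ := |(k : ℝ)| with ha
    have ha0 : 0 ≤ a := abs_nonneg _
    have hk2 : (k : ℝ) ^ 2 = a ^ 2 := by rw [ha, sq_abs]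
    have hlog : Real.log (a + 4) ≤ 2 * Real.sqrt (a + 4) := log_le_two_mul_sqrt (by linarith)
    have hsqrt : Real.sqrt (a + 4) ≤ 2 * Real.sqrt (1 + a) := by
      rw [show (2 : ℝ) * Real.sqrt (1 + a) = Real.sqrt (4 * (1 + a)) by
        rw [Real.sqrt_mul (by norm_num : (0 : ℝ) ≤ 4),
          show Real.sqrt 4 = 2 by rw [show (4 : ℝ) = 2 ^ 2 by norm_num, Real.sqrt_sq (by norm_num)]]]
      exact Real.sqrt_le_sqrt (by linarith)
    -- `(1 + a)^{-3/2} = 1/((1+a) √(1+a))`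
    have hpow : (1 + a) ^ (-(3 / 2 : ℝ)) = 1 / ((1 + a) * Real.sqrt (1 + a)) := by
      rw [Real.rpow_neg (by linarith), one_div, show (3 / 2 : ℝ) = 1 + 1 / 2 by norm_num,
        Real.rpow_add (by linarith), Real.rpow_one, Real.sqrt_eq_rpow]
    rw [hk2, hpow]
    have hs0 : 0 < Real.sqrt (1 + a) := Real.sqrt_pos.2 (by linarith)
    have hs2 : Real.sqrt (1 + a) ^ 2 = 1 + a := Real.sq_sqrt (by linarith)
    rw [mul_one_div, div_le_div_iff₀ (by positivity) (by positivity)]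
    -- goal: (A + log(a+4)) * ((1+a) √(1+a)) ≤ (2A + 8) * (1 + a²)
    have h1 : Real.log (a + 4) ≤ 4 * Real.sqrt (1 + a) := by linarith
    have h2 : Real.sqrt (1 + a) ≤ 1 + a := by
      nlinarith [hs2, hs0]
    have h3 : (1 + a) * Real.sqrt (1 + a) ≤ (1 + a) ^ 2 := by nlinarith
    have h4 : (1 + a) ^ 2 ≤ 2 * (1 + a ^ 2) := by nlinarith [sq_nonneg (a - 1)]
    have hlog0 : 0 ≤ Real.log (a + 4) := Real.log_nonneg (by linarith)
    calc (A + Real.log (a + 4)) * ((1 + a) * Real.sqrt (1 + a))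
        ≤ A * ((1 + a) * Real.sqrt (1 + a)) + 4 * Real.sqrt (1 + a) * ((1 + a) * Real.sqrt (1 + a)) := by
          nlinarith [mul_nonneg (by linarith : (0:ℝ) ≤ 1 + a) hs0.le]
      _ = A * ((1 + a) * Real.sqrt (1 + a)) + 4 * (1 + a) * Real.sqrt (1 + a) ^ 2 := by ring
      _ ≤ A * (2 * (1 + a ^ 2)) + 4 * (2 * (1 + a ^ 2)) := by
          rw [hs2]
          have e1 : (1 + a) * Real.sqrt (1 + a) ≤ 2 * (1 + a ^ 2) := h3.trans h4
          have e2 : (1 + a) * (1 + a) ≤ 2 * (1 + a ^ 2) := by nlinarith [sq_nonneg (a - 1)]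
          nlinarith
      _ = (2 * A + 8) * (1 + a ^ 2) := by ring

/-- **`Σ_ρ m(ρ)/(1 + γ²) < ∞`** over the non-trivial zeros of `L(s, χ)` for a primitive `χ` mod
`q > 1`, the zeros counted with multiplicity `m = DirichletDisc.zeroOrder χ` (from
`N(T+1, χ) − N(T, χ) ≪ log q(|T|+4)`, MV Thm. 10.17). [cite: MontgomeryVaughan2007, Theorem 10.17] -/
theorem summable_zeroOrder_div_one_add_sq (hprim : χ.IsPrimitive) (hq : 1 < q) :
    Summable fun ρ : charNontrivialZeros χ =>
      (DirichletDisc.zeroOrder χ (ρ : ℂ) : ℝ) / (1 + (ρ : ℂ).im ^ 2) := by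
  classical
  obtain ⟨C, hC0, hC⟩ := exists_sum_window_le
  have hq0 : 0 ≤ Real.log q := Real.log_natCast_nonneg q
  set g : ℤ → ℝ := fun k => 4 * C * ((Real.log q + Real.log (|(k : ℝ)| + 4)) / (1 + (k : ℝ) ^ 2)) with hg
  have hgsum : Summable g := (summable_window_weight hq0).mul_left (4 * C)
  have hg0 : ∀ k, 0 ≤ g k := fun k => by
    have : 0 ≤ Real.log (|(k : ℝ)| + 4) := Real.log_nonneg (by linarith [abs_nonneg (k : ℝ)])
    positivity
  refine summable_of_sum_le (fun ρ => by positivity) (c := ∑' k, g k) fun u => ?_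
  -- group the zeros of `u` by the nearest integer to their ordinate
  set kf : charNontrivialZeros χ → ℤ := fun ρ => round ((ρ : ℂ).im) with hkf
  rw [← Finset.sum_fiberwise_of_maps_to (g := kf) (fun ρ _ => Finset.mem_image_of_mem kf ‹_›)]
  refine (Finset.sum_le_sum fun k hk => ?_).trans
    (hgsum.sum_le_tsum _ (fun k _ => hg0 k))
  -- the fibre at `k`
  have hfib : ∀ ρ ∈ u.filter (fun ρ => kf ρ = k), |(ρ : ℂ).im - k| ≤ 1 / 2 := by
    intro ρ hρ
    have h := (Finset.mem_filter.1 hρ).2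
    rw [hkf] at h
    rw [← h]
    exact abs_sub_round _
  have hwin := hC q χ hprim hq (k : ℝ) ((u.filter (fun ρ => kf ρ = k)).image Subtype.val) (by
    intro z hz
    obtain ⟨ρ, hρ, rfl⟩ := Finset.mem_image.1 hz
    exact ⟨ρ.2.1, ρ.2.2.1, ρ.2.2.2, hfib ρ hρ⟩)
  rw [Finset.sum_image (fun a _ b _ h => Subtype.ext h)] at hwin
  have hbound : ∀ ρ ∈ u.filter (fun ρ => kf ρ = k),
      (DirichletDisc.zeroOrder χ (ρ : ℂ) : ℝ) / (1 + (ρ : ℂ).im ^ 2) ≤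
        (4 / (1 + (k : ℝ) ^ 2)) * (DirichletDisc.zeroOrder χ (ρ : ℂ) : ℝ) := by
    intro ρ hρ
    have h1 := hfib ρ hρ
    have hden : 1 + (k : ℝ) ^ 2 ≤ 4 * (1 + (ρ : ℂ).im ^ 2) := by
      have h2 : |(k : ℝ)| ≤ |(ρ : ℂ).im| + 1 / 2 := by
        have := abs_sub_abs_le_abs_sub (k : ℝ) (ρ : ℂ).im
        rw [abs_sub_comm] at this
        linarith
      have h3 : (k : ℝ) ^ 2 ≤ (|(ρ : ℂ).im| + 1 / 2) ^ 2 := by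
        rw [← sq_abs (k : ℝ)]; exact pow_le_pow_left₀ (abs_nonneg _) h2 2
      nlinarith [sq_nonneg (|(ρ : ℂ).im| - 1 / 2), sq_abs ((ρ : ℂ).im), abs_nonneg ((ρ : ℂ).im)]
    rw [div_le_iff₀ (by positivity), mul_comm, ← mul_assoc]
    refine le_mul_of_one_le_left (Nat.cast_nonneg _) ?_
    rw [mul_div_assoc', one_le_div (by positivity)]
    linarith
  calc ∑ ρ ∈ u.filter (fun ρ => kf ρ = k), (DirichletDisc.zeroOrder χ (ρ : ℂ) : ℝ) / (1 + (ρ : ℂ).im ^ 2)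
      ≤ ∑ ρ ∈ u.filter (fun ρ => kf ρ = k), (4 / (1 + (k : ℝ) ^ 2)) * (DirichletDisc.zeroOrder χ (ρ : ℂ) : ℝ) :=
        Finset.sum_le_sum hbound
    _ = (4 / (1 + (k : ℝ) ^ 2)) * ∑ ρ ∈ u.filter (fun ρ => kf ρ = k), (DirichletDisc.zeroOrder χ (ρ : ℂ) : ℝ) := by
        rw [Finset.mul_sum]
    _ ≤ (4 / (1 + (k : ℝ) ^ 2)) * (C * (Real.log q + Real.log (|(k : ℝ)| + 4))) :=
        mul_le_mul_of_nonneg_left hwin (by positivity)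
    _ = g k := by rw [hg]; ring

/-- The complex-weighted version: `Σ_ρ ‖m(ρ) · c/(1+γ²)‖`-type comparison — for any `F` with
`‖F ρ‖ ≤ B · m(ρ)/(1 + γ²)`, `Σ_ρ F ρ` converges absolutely. [folklore] -/
theorem summable_of_norm_le_mul_zeroOrder_div (hprim : χ.IsPrimitive) (hq : 1 < q) {B : ℝ}
    {F : charNontrivialZeros χ → ℂ}
    (hF : ∀ ρ, ‖F ρ‖ ≤ B * ((DirichletDisc.zeroOrder χ (ρ : ℂ) : ℝ) / (1 + (ρ : ℂ).im ^ 2))) :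
    Summable fun ρ => ‖F ρ‖ :=
  Summable.of_nonneg_of_le (fun _ => norm_nonneg _) hF
    ((summable_zeroOrder_div_one_add_sq hprim hq).mul_left B)

end ExplicitPsiChar

end Literature.NumberTheory.LFunctions

end
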